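import Summits.QuantumFields.YangMills.Theorems.ToronSmallBallOwnAxisShiftNumerics
import HarnessLib

/-!
# Numeric inequalities for the equator-band and flux-suppression windows

Support module (`--supports` stmt-QuantumFields-24093, `QuantileBitPurity.EquatorBandVanishing`; seat ym-dw-p1 g17).  Pure real-variable bookkeeping,
no lattice object.  The own-axis strip estimate `OwnAxis.sectorWeight_stripGen_le_rpow_of_numerics` is used here AT THE EQUATOR with core radius
`c₀ = 1` and floor `σ = 1/4` (the holonomy axis is perfectly conditioned there), closeness scale `η = β^(−(1/2 − δ))`, `K = ⌈64 e β^a⌉₊` translates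
of step `θ' = 6w`; the band half-width is either `w = 8L²η` (the THIN band of the flux-reflection lever) or `w = β^(−γc)` (the WIDE equator band of the
crux).  We prove: the bad-field inequality for a general closeness exponent (★ `ineq_bad_gen`: `4L e^{−β^{2δ}/2}(β^{315L³})^{2L} ≤ β^{−a}/2` on
`L ≤ β^a`, `10a ≤ δ ≤ 1/4`), the shift/Jacobian/cost inequalities from ONE master bound on the total shift `Kθ'` (`shift_jac_cost_of_master`), and the
two packaged parameter sets ★ `numericsThin_of_le` (`a = 1/400`, `δ = 1/40`) and ★ `numericsWide` (`a = γc/40`, `δ = γc/4`, every `0 < γc ≤ 2/5`).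

HONEST FRAMING: elementary real analysis; nothing about lattice gauge theory.  No `sorry`, no new axiom, no new definition.  References: [folklore].
-/

set_option autoImplicit false

noncomputable section

open Real

namespace Summit.QuantumFields.YangMills.Theorems.FemtoTransferGap.OwnAxis

section Ineq

variable {a δ β : ℝ} {L : ℕ}

/-- `β η² = β^{2δ}` for `η = β^{−(1/2 − δ)}`. [folklore] -/
theorem beta_mul_eta_sq (hβ0 : 0 < β) (δ : ℝ) : β * (β ^ (-(1 / 2 - δ))) ^ 2 = β ^ (2 * δ) := by
  rw [← Real.rpow_natCast (β ^ (-(1 / 2 - δ))) 2, ← Real.rpow_mul hβ0.le]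
  nth_rw 1 [← Real.rpow_one β]
  rw [← Real.rpow_add hβ0]
  congr 1; push_cast; ring

/-- ★ (bad fields, general closeness exponent) `4 L e^{−β^{2δ}/2} (β^{315L³})^{2L} ≤ β^{−a}/2` for `L ≤ β^a`, `0 < a`, `10a ≤ δ ≤ 1/4`, `β` large.
[folklore] -/
theorem ineq_bad_gen (ha : 0 < a) (haδ : 10 * a ≤ δ) (hδ : δ ≤ 1 / 4) (hβ1 : 1 ≤ β) (hL : (L : ℝ) ≤ β ^ a)
    (hβA : ((5048 : ℝ) / δ) ^ (1 / δ) ≤ β) (hβB : (12 : ℝ) ^ (1 / δ) ≤ β) :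
    4 * (L : ℝ) * Real.exp (-(β * (β ^ (-(1 / 2 - δ))) ^ 2 / 2)) * (β ^ (315 * L ^ 3)) ^ (2 * L) ≤ β ^ (-a) / 2 := by
  have hβ0 : 0 < β := by linarith
  have hδ0 : 0 < δ := by linarith
  have hLr : (0 : ℝ) ≤ L := Nat.cast_nonneg L
  rw [beta_mul_eta_sq hβ0]
  set x : ℝ := β ^ (2 * δ) / 2 with hx
  have hL4 : (L : ℝ) ^ 4 ≤ β ^ ((4 : ℝ) * a) := by
    have h := pow_le_rpow_mul hβ0.le hLr hL 4; norm_num at h; exact h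
  set P : ℝ := β ^ (630 * β ^ ((4 : ℝ) * a)) with hP
  have hpow : (β ^ (315 * L ^ 3)) ^ (2 * L) ≤ P := by
    rw [← pow_mul, ← Real.rpow_natCast]
    refine Real.rpow_le_rpow_of_exponent_le hβ1 ?_
    push_cast
    nlinarith
  have hP0 : 0 ≤ P := by positivity
  -- `log β ≤ β^{δ/2} / (δ/2)`
  have hlogβ : Real.log β ≤ β ^ (δ / 2) / (δ / 2) := Real.log_le_rpow_div hβ0.le (by positivity)
  have hlog0 : 0 ≤ Real.log β := Real.log_nonneg hβ1
  have hb4 : 1 ≤ β ^ ((4 : ℝ) * a) := Real.one_le_rpow hβ1 (by positivity)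
  have hba : β ^ ((4 : ℝ) * a) ≤ β ^ (2 * δ / 5) := Real.rpow_le_rpow_of_exponent_le hβ1 (by linarith)
  -- `β^{δ/2} · β^{2δ/5} = β^{9δ/10}` and `(5048/δ) β^{9δ/10} ≤ β^{2δ}` from `hβA`
  have hprod : β ^ (δ / 2) * β ^ (2 * δ / 5) = β ^ (9 * δ / 10) := by rw [← Real.rpow_add hβ0]; ring_nf
  have hA : 5048 / δ ≤ β ^ δ := by
    have h := Real.rpow_le_rpow (by positivity) hβA hδ0.le
    rwa [← Real.rpow_mul (by positivity), show 1 / δ * δ = 1 by field_simp, Real.rpow_one] at h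
  have hA' : 5048 / δ * β ^ (9 * δ / 10) ≤ β ^ (2 * δ) := by
    have h := mul_le_mul_of_nonneg_right hA (Real.rpow_nonneg hβ0.le (9 * δ / 10))
    rw [← Real.rpow_add hβ0] at h
    have : β ^ (δ + 9 * δ / 10) ≤ β ^ (2 * δ) := Real.rpow_le_rpow_of_exponent_le hβ1 (by linarith)
    exact h.trans this
  have hB : 12 ≤ β ^ δ := by
    have h := Real.rpow_le_rpow (by positivity) hβB hδ0.le
    rwa [← Real.rpow_mul (by positivity), show 1 / δ * δ = 1 by field_simp, Real.rpow_one] at h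
  have hB' : (12 : ℝ) ≤ β ^ (2 * δ) := hB.trans (Real.rpow_le_rpow_of_exponent_le hβ1 (by linarith))
  have hl8 : Real.log 8 ≤ 3 := by
    have h8 : (8 : ℝ) ≤ Real.exp 1 ^ 3 := by
      have h2 : (2 : ℝ) ≤ Real.exp 1 := by have := Real.add_one_le_exp (1 : ℝ); linarith
      have := pow_le_pow_left₀ (by norm_num) h2 3
      linarith
    calc Real.log 8 ≤ Real.log (Real.exp 1 ^ 3) := Real.log_le_log (by norm_num) h8
      _ = 3 := by rw [Real.log_pow, Real.log_exp]; norm_num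
  have hmain : Real.log 8 + Real.log β * (2 * a + 630 * β ^ ((4 : ℝ) * a)) ≤ x := by
    have h1 : Real.log β * (2 * a + 630 * β ^ ((4 : ℝ) * a)) ≤ (β ^ (δ / 2) / (δ / 2)) * (631 * β ^ (2 * δ / 5)) :=
      mul_le_mul hlogβ (by nlinarith) (by positivity) (by positivity)
    have h2 : (β ^ (δ / 2) / (δ / 2)) * (631 * β ^ (2 * δ / 5)) = (1262 / δ) * (β ^ (δ / 2) * β ^ (2 * δ / 5)) := by
      field_simp; ring
    rw [h2, hprod] at h1
    have h3 : (1262 / δ) * β ^ (9 * δ / 10) ≤ x / 2 := by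
      rw [hx]
      have : (1262 : ℝ) / δ = (5048 / δ) / 4 := by ring
      rw [this]
      linarith
    rw [hx] at h3 ⊢
    linarith
  -- `8 β^{2a} P ≤ exp x`
  have hBexp : 8 * (β ^ a * β ^ a * P) ≤ Real.exp x := by
    have h8 : (8 : ℝ) * (β ^ a * β ^ a * P) = Real.exp (Real.log 8 + Real.log β * (2 * a + 630 * β ^ ((4 : ℝ) * a))) := by
      rw [Real.exp_add, Real.exp_log (by norm_num), hP, ← Real.rpow_add hβ0, ← Real.rpow_add hβ0, Real.rpow_def_of_pos hβ0]
      congr 2; ring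
    rw [h8]
    exact Real.exp_le_exp.2 hmain
  have hβa : 0 < β ^ a := Real.rpow_pos_of_pos hβ0 a
  calc 4 * (L : ℝ) * Real.exp (-x) * (β ^ (315 * L ^ 3)) ^ (2 * L) ≤ 4 * β ^ a * Real.exp (-x) * P := by gcongr
    _ = (8 * (β ^ a * β ^ a * P)) * (Real.exp (-x) / (2 * β ^ a)) := by field_simp; ring
    _ ≤ Real.exp x * (Real.exp (-x) / (2 * β ^ a)) := mul_le_mul_of_nonneg_right hBexp (by positivity)
    _ = β ^ (-a) / 2 := by rw [Real.exp_neg, Real.rpow_neg hβ0.le]; field_simp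

/-- ★ (shift, Jacobian, cost from ONE master bound) with floor `σ = 1/4`: if `P = Kθ' ≥ 0`, `βη² ≥ 1`, `L ≥ 1` and `1000 L⁶ P (βη²) ≤ 1` then
`P ≤ (1/4)/2`, `4L⁴(P/(1/4)) ≤ 1/2` and `12βL⁴((P(2Lη/(1/4)))² + 2(P(2Lη/(1/4)))η) ≤ 1`. [folklore] -/
theorem shift_jac_cost_of_master {P η : ℝ} (hP0 : 0 ≤ P) (hβη : 1 ≤ β * η ^ 2) (hL1 : (1 : ℝ) ≤ L)
    (hM : 1000 * (L : ℝ) ^ 6 * P * (β * η ^ 2) ≤ 1) :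
    P ≤ 1 / 4 / 2 ∧ 4 * (L : ℝ) ^ 4 * (P / (1 / 4)) ≤ 1 / 2 ∧
      12 * β * (L : ℝ) ^ 4 * ((P * (2 * (L * η) / (1 / 4))) ^ 2 + 2 * (P * (2 * (L * η) / (1 / 4))) * η) ≤ 1 := by
  have hL6 : (1 : ℝ) ≤ (L : ℝ) ^ 6 := one_le_pow₀ hL1
  have hL4 : (1 : ℝ) ≤ (L : ℝ) ^ 4 := one_le_pow₀ hL1
  have hPL : (L : ℝ) ^ 6 * P ≤ 1 / 1000 := by nlinarith
  have hP1 : P ≤ 1 / 1000 := by nlinarith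
  refine ⟨by linarith, ?_, ?_⟩
  · have : (L : ℝ) ^ 4 * P ≤ 1 / 1000 := by nlinarith [pow_le_pow_right₀ hL1 (show 4 ≤ 6 by norm_num)]
    nlinarith
  · have e : 12 * β * (L : ℝ) ^ 4 * ((P * (2 * (L * η) / (1 / 4))) ^ 2 + 2 * (P * (2 * (L * η) / (1 / 4))) * η) =
        768 * ((L : ℝ) ^ 6 * P * (β * η ^ 2)) * P + 192 * ((L : ℝ) ^ 5 * P * (β * η ^ 2)) := by ring
    rw [e]
    have h5 : (L : ℝ) ^ 5 * P * (β * η ^ 2) ≤ (L : ℝ) ^ 6 * P * (β * η ^ 2) := by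
      have : (L : ℝ) ^ 5 ≤ (L : ℝ) ^ 6 := pow_le_pow_right₀ hL1 (by norm_num)
      have hb : 0 ≤ P * (β * η ^ 2) := by positivity
      nlinarith
    nlinarith

/-- ★ (floor at the equator) `4L(Lη) ≤ 1/2 − 1/4` and `8L²η ≤ 1/2` once `32 L² η ≤ 1`. [folklore] -/
theorem floor_of_small {η : ℝ} (h : 32 * (L : ℝ) ^ 2 * η ≤ 1) :
    4 * ((L : ℝ) * (L * η)) ≤ 1 / 2 - 1 / 4 ∧ 8 * (L : ℝ) ^ 2 * η ≤ 1 / 2 := by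
  constructor <;> nlinarith

end Ineq

/-! ## The two parameter sets -/

section Sets

variable {β : ℝ} {L : ℕ}

/-- The generic smallness `M β^e ≤ 1` bundled with `L^k ≤ β^{ka}`: `M L^k β^{e₀} ≤ 1` once `M β^{ka + e₀} ≤ 1`. [folklore] -/
theorem mul_pow_rpow_le_one {M e₀ : ℝ} (hM : 0 < M) (hβ0 : 0 < β) (hL0 : (0 : ℝ) ≤ L) {aw : ℝ} (hL : (L : ℝ) ≤ β ^ aw) (k : ℕ)
    (hkey : M * β ^ ((k : ℝ) * aw + e₀) ≤ 1) : M * (L : ℝ) ^ k * β ^ e₀ ≤ 1 := by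
  have hLk : (L : ℝ) ^ k ≤ β ^ ((k : ℝ) * aw) := pow_le_rpow_mul hβ0.le hL0 hL k
  have hsplit : β ^ ((k : ℝ) * aw + e₀) = β ^ ((k : ℝ) * aw) * β ^ e₀ := Real.rpow_add hβ0 _ _
  rw [hsplit] at hkey
  have he : 0 ≤ β ^ e₀ := Real.rpow_nonneg hβ0.le _
  calc M * (L : ℝ) ^ k * β ^ e₀ ≤ M * β ^ ((k : ℝ) * aw) * β ^ e₀ := by gcongr
    _ = M * (β ^ ((k : ℝ) * aw) * β ^ e₀) := by ring
    _ ≤ 1 := hkey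

end Sets


/-! ## The two parameter sets -/

section Packages

variable {β : ℝ} {L : ℕ}

/-- (thin) master smallness: `1000 L⁶ (K · 6 · 8L²η) (βη²) ≤ 1` with `η = β^{−(1/2 − 1/40)}`, `K = ⌈64eβ^a⌉₊`, `L ≤ β^a`, `a ≤ 1/400`. [folklore] -/
theorem master_thin {a : ℝ} (ha : 0 < a) (ha' : a ≤ 1 / 400) (hβ1 : 1 ≤ β) (hL : (L : ℝ) ≤ β ^ a)
    (hβ : ((9264000 : ℝ)) ^ (1 / (-(9 * a - 17 / 40))) ≤ β) :
    1000 * (L : ℝ) ^ 6 * (((⌈64 * Real.exp 1 * β ^ a⌉₊ : ℕ) : ℝ) * (6 * (8 * (L : ℝ) ^ 2 * β ^ (-(1 / 2 - 1 / 40 : ℝ))))) *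
      (β * (β ^ (-(1 / 2 - 1 / 40 : ℝ))) ^ 2) ≤ 1 := by
  have hβ0 : 0 < β := by linarith
  have hK := ceil_le_bound hβ1 ha.le
  rw [beta_mul_eta_sq hβ0]
  have hL8 : (L : ℝ) ^ 8 ≤ β ^ ((8 : ℕ) * a) := pow_le_rpow_mul hβ0.le (Nat.cast_nonneg L) hL 8
  have key : 9264000 * β ^ (9 * a - 17 / 40) ≤ 1 := mul_rpow_le_one_of_le (by norm_num) (by linarith) hβ
  have hsplit : β ^ (9 * a - 17 / 40) = β ^ a * β ^ ((8 : ℕ) * a) * β ^ (-(1 / 2 - 1 / 40 : ℝ)) * β ^ (2 * (1 / 40 : ℝ)) := by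
    rw [← Real.rpow_add hβ0, ← Real.rpow_add hβ0, ← Real.rpow_add hβ0]; congr 1; push_cast; ring
  rw [hsplit] at key
  have hη0 : 0 ≤ β ^ (-(1 / 2 - 1 / 40 : ℝ)) := Real.rpow_nonneg hβ0.le _
  have h2 : 0 ≤ β ^ (2 * (1 / 40 : ℝ)) := Real.rpow_nonneg hβ0.le _
  have hL0 : (0 : ℝ) ≤ L := Nat.cast_nonneg L
  calc 1000 * (L : ℝ) ^ 6 * (((⌈64 * Real.exp 1 * β ^ a⌉₊ : ℕ) : ℝ) * (6 * (8 * (L : ℝ) ^ 2 * β ^ (-(1 / 2 - 1 / 40 : ℝ))))) * β ^ (2 * (1 / 40 : ℝ))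
      = 48000 * (((⌈64 * Real.exp 1 * β ^ a⌉₊ : ℕ) : ℝ) * ((L : ℝ) ^ 8 * (β ^ (-(1 / 2 - 1 / 40 : ℝ)) * β ^ (2 * (1 / 40 : ℝ))))) := by ring
    _ ≤ 48000 * ((193 * β ^ a) * (β ^ ((8 : ℕ) * a) * (β ^ (-(1 / 2 - 1 / 40 : ℝ)) * β ^ (2 * (1 / 40 : ℝ))))) := by gcongr
    _ = 9264000 * (β ^ a * β ^ ((8 : ℕ) * a) * β ^ (-(1 / 2 - 1 / 40 : ℝ)) * β ^ (2 * (1 / 40 : ℝ))) := by ring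
    _ ≤ 1 := key

/-- (thin) `32 L² η ≤ 1`. [folklore] -/
theorem small_thin {a : ℝ} (ha : 0 < a) (ha' : a ≤ 1 / 400) (hβ1 : 1 ≤ β) (hL : (L : ℝ) ≤ β ^ a)
    (hβ : (32 : ℝ) ^ (1 / (-(2 * a - 19 / 40))) ≤ β) : 32 * (L : ℝ) ^ 2 * β ^ (-(1 / 2 - 1 / 40 : ℝ)) ≤ 1 := by
  have hβ0 : 0 < β := by linarith
  have key : 32 * β ^ (2 * a - 19 / 40) ≤ 1 := mul_rpow_le_one_of_le (by norm_num) (by linarith) hβ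
  have h := mul_pow_rpow_le_one (M := 32) (aw := a) (e₀ := -(1 / 2 - 1 / 40 : ℝ)) (by norm_num) hβ0 (Nat.cast_nonneg L) hL 2
    (by rw [show ((2 : ℕ) : ℝ) * a + -(1 / 2 - 1 / 40 : ℝ) = 2 * a - 19 / 40 by push_cast; ring]; exact key)
  exact h

/-- ★ **The THIN-band parameter set** (`a ≤ 1/400`, `η = β^{−(1/2 − 1/40)}`, `w = 8L²η`, `K = ⌈64eβ^a⌉₊`): all numeric inputs for `β ≥ β₀(a)` and
`1 ≤ L ≤ β^a`. [folklore] -/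
theorem numericsThin_of_le {a : ℝ} (ha : 0 < a) (ha' : a ≤ 1 / 400) :
    ∃ β₀ : ℝ, ∀ β : ℝ, β₀ ≤ β → ∀ L : ℕ, 1 ≤ L → (L : ℝ) ≤ β ^ a →
      200 ≤ β ∧ 0 < β ^ (-(1 / 2 - 1 / 40 : ℝ)) ∧ 32 * (L : ℝ) ^ 2 * β ^ (-(1 / 2 - 1 / 40 : ℝ)) ≤ 1 ∧ 1 ≤ ⌈64 * Real.exp 1 * β ^ a⌉₊ ∧
      1 ≤ β * (β ^ (-(1 / 2 - 1 / 40 : ℝ))) ^ 2 ∧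
      1000 * (L : ℝ) ^ 6 * (((⌈64 * Real.exp 1 * β ^ a⌉₊ : ℕ) : ℝ) * (6 * (8 * (L : ℝ) ^ 2 * β ^ (-(1 / 2 - 1 / 40 : ℝ))))) *
        (β * (β ^ (-(1 / 2 - 1 / 40 : ℝ))) ^ 2) ≤ 1 ∧
      4 * (L : ℝ) * Real.exp (-(β * (β ^ (-(1 / 2 - 1 / 40 : ℝ))) ^ 2 / 2)) * (β ^ (315 * L ^ 3)) ^ (2 * L) ≤ β ^ (-a) / 2 ∧
      32 * Real.exp 1 / ((⌈64 * Real.exp 1 * β ^ a⌉₊ : ℕ) : ℝ) ≤ β ^ (-a) / 2 := by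
  refine ⟨max (max 200 ((9264000 : ℝ) ^ (1 / (-(9 * a - 17 / 40))))) (max ((32 : ℝ) ^ (1 / (-(2 * a - 19 / 40))))
    (max (((5048 : ℝ) / (1 / 40)) ^ (1 / (1 / 40 : ℝ))) ((12 : ℝ) ^ (1 / (1 / 40 : ℝ))))), fun β hβ L hL1 hL => ?_⟩
  simp only [max_le_iff] at hβ
  obtain ⟨⟨h200, h92⟩, h32, hA, hB⟩ := hβ
  have hβ1 : 1 ≤ β := by linarith
  have hβ0 : 0 < β := by linarith
  refine ⟨h200, Real.rpow_pos_of_pos hβ0 _, small_thin ha ha' hβ1 hL h32, Nat.one_le_ceil_iff.2 (by positivity), ?_,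
    master_thin ha ha' hβ1 hL h92, ineq_bad_gen ha (by linarith) (by norm_num) hβ1 hL hA hB, ineq_count hβ1⟩
  rw [beta_mul_eta_sq hβ0]
  exact Real.one_le_rpow hβ1 (by norm_num)

/-- (wide) master smallness: `1000 L⁶ (K · 6β^{−γ}) (βη²) ≤ 1` with `η = β^{−(1/2 − γ/4)}`, `K = ⌈64eβ^{γ/40}⌉₊`, `L ≤ β^{γ/40}`. [folklore] -/
theorem master_wide {γ : ℝ} (hγ : 0 < γ) (hβ1 : 1 ≤ β) (hL : (L : ℝ) ≤ β ^ (γ / 40))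
    (hβ : ((1158000 : ℝ)) ^ (1 / (-(-(13 * γ / 40)))) ≤ β) :
    1000 * (L : ℝ) ^ 6 * (((⌈64 * Real.exp 1 * β ^ (γ / 40)⌉₊ : ℕ) : ℝ) * (6 * β ^ (-γ))) * (β * (β ^ (-(1 / 2 - γ / 4))) ^ 2) ≤ 1 := by
  have hβ0 : 0 < β := by linarith
  have hK := ceil_le_bound hβ1 (by positivity : 0 ≤ γ / 40)
  rw [beta_mul_eta_sq hβ0]
  have hL6 : (L : ℝ) ^ 6 ≤ β ^ ((6 : ℕ) * (γ / 40)) := pow_le_rpow_mul hβ0.le (Nat.cast_nonneg L) hL 6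
  have key : 1158000 * β ^ (-(13 * γ / 40)) ≤ 1 := mul_rpow_le_one_of_le (by norm_num) (by linarith) hβ
  have hsplit : β ^ (-(13 * γ / 40)) = β ^ ((6 : ℕ) * (γ / 40)) * β ^ (γ / 40) * β ^ (-γ) * β ^ (2 * (γ / 4)) := by
    rw [← Real.rpow_add hβ0, ← Real.rpow_add hβ0, ← Real.rpow_add hβ0]; congr 1; push_cast; ring
  rw [hsplit] at key
  have hL0 : (0 : ℝ) ≤ L := Nat.cast_nonneg L
  have hg0 : 0 ≤ β ^ (-γ) := Real.rpow_nonneg hβ0.le _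
  have h2 : 0 ≤ β ^ (2 * (γ / 4)) := Real.rpow_nonneg hβ0.le _
  calc 1000 * (L : ℝ) ^ 6 * (((⌈64 * Real.exp 1 * β ^ (γ / 40)⌉₊ : ℕ) : ℝ) * (6 * β ^ (-γ))) * β ^ (2 * (γ / 4))
      = 6000 * ((L : ℝ) ^ 6 * ((((⌈64 * Real.exp 1 * β ^ (γ / 40)⌉₊ : ℕ) : ℝ)) * (β ^ (-γ) * β ^ (2 * (γ / 4))))) := by ring
    _ ≤ 6000 * (β ^ ((6 : ℕ) * (γ / 40)) * ((193 * β ^ (γ / 40)) * (β ^ (-γ) * β ^ (2 * (γ / 4))))) := by gcongr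
    _ = 1158000 * (β ^ ((6 : ℕ) * (γ / 40)) * β ^ (γ / 40) * β ^ (-γ) * β ^ (2 * (γ / 4))) := by ring
    _ ≤ 1 := key

/-- (wide) `32 L² η ≤ 1` with `η = β^{−(1/2 − γ/4)}`, `L ≤ β^{γ/40}`, `γ ≤ 2/5`. [folklore] -/
theorem small_wide {γ : ℝ} (hγ : 0 < γ) (hγ' : γ ≤ 2 / 5) (hβ1 : 1 ≤ β) (hL : (L : ℝ) ≤ β ^ (γ / 40))
    (hβ : (32 : ℝ) ^ (1 / (-(2 * (γ / 40) + -(1 / 2 - γ / 4)))) ≤ β) : 32 * (L : ℝ) ^ 2 * β ^ (-(1 / 2 - γ / 4)) ≤ 1 := by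
  have hβ0 : 0 < β := by linarith
  have key : 32 * β ^ (2 * (γ / 40) + -(1 / 2 - γ / 4)) ≤ 1 := mul_rpow_le_one_of_le (by norm_num) (by linarith) hβ
  exact mul_pow_rpow_le_one (M := 32) (aw := γ / 40) (e₀ := -(1 / 2 - γ / 4)) (by norm_num) hβ0 (Nat.cast_nonneg L) hL 2
    (by rw [show ((2 : ℕ) : ℝ) * (γ / 40) = 2 * (γ / 40) by push_cast; ring]; exact key)

/-- ★ **The WIDE-band parameter set** (every `0 < γ ≤ 2/5`: window and rate `a = γ/40`, `η = β^{−(1/2 − γ/4)}`, `w = β^{−γ}`, `K = ⌈64eβ^a⌉₊`).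
[folklore] -/
theorem numericsWide {γ : ℝ} (hγ : 0 < γ) (hγ' : γ ≤ 2 / 5) :
    ∃ β₀ : ℝ, ∀ β : ℝ, β₀ ≤ β → ∀ L : ℕ, 1 ≤ L → (L : ℝ) ≤ β ^ (γ / 40) →
      200 ≤ β ∧ 0 < β ^ (-(1 / 2 - γ / 4)) ∧ 32 * (L : ℝ) ^ 2 * β ^ (-(1 / 2 - γ / 4)) ≤ 1 ∧ 1 ≤ ⌈64 * Real.exp 1 * β ^ (γ / 40)⌉₊ ∧
      1 ≤ β * (β ^ (-(1 / 2 - γ / 4))) ^ 2 ∧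
      1000 * (L : ℝ) ^ 6 * (((⌈64 * Real.exp 1 * β ^ (γ / 40)⌉₊ : ℕ) : ℝ) * (6 * β ^ (-γ))) * (β * (β ^ (-(1 / 2 - γ / 4))) ^ 2) ≤ 1 ∧
      4 * (L : ℝ) * Real.exp (-(β * (β ^ (-(1 / 2 - γ / 4))) ^ 2 / 2)) * (β ^ (315 * L ^ 3)) ^ (2 * L) ≤ β ^ (-(γ / 40)) / 2 ∧
      32 * Real.exp 1 / ((⌈64 * Real.exp 1 * β ^ (γ / 40)⌉₊ : ℕ) : ℝ) ≤ β ^ (-(γ / 40)) / 2 ∧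
      0 < β ^ (-γ) ∧ β ^ (-γ) ≤ 1 / 2 := by
  refine ⟨max (max 200 ((1158000 : ℝ) ^ (1 / (-(-(13 * γ / 40)))))) (max ((32 : ℝ) ^ (1 / (-(2 * (γ / 40) + -(1 / 2 - γ / 4)))))
    (max (((5048 : ℝ) / (γ / 4)) ^ (1 / (γ / 4))) (max ((12 : ℝ) ^ (1 / (γ / 4))) ((2 : ℝ) ^ (1 / (-(-γ))))))), fun β hβ L hL1 hL => ?_⟩
  simp only [max_le_iff] at hβ
  obtain ⟨⟨h200, h11⟩, h32, hA, hB, h2⟩ := hβ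
  have hβ1 : 1 ≤ β := by linarith
  have hβ0 : 0 < β := by linarith
  refine ⟨h200, Real.rpow_pos_of_pos hβ0 _, small_wide hγ hγ' hβ1 hL h32, Nat.one_le_ceil_iff.2 (by positivity), ?_,
    master_wide hγ hβ1 hL h11, ineq_bad_gen (by positivity) (by linarith) (by linarith) hβ1 hL hA hB, ineq_count hβ1,
    Real.rpow_pos_of_pos hβ0 _, ?_⟩
  · rw [beta_mul_eta_sq hβ0]; exact Real.one_le_rpow hβ1 (by linarith)
  · have key : 2 * β ^ (-γ) ≤ 1 := mul_rpow_le_one_of_le (by norm_num) (by linarith) h2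
    linarith

end Packages

end Summit.QuantumFields.YangMills.Theorems.FemtoTransferGap.OwnAxis

end
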